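import Summits.CriticalPhenomena.CardyFormulaZ2.Theorems.CardyIKTransportIKMixedBoxCrossingSplit

/-!
# Line `quenched-chain-fkg` (strategist ALT line, crux stmt-CriticalPhenomena-5911 `IKMixedBoxCrossing`)

Strategist seat `cstrat-stmt-CriticalPhenomena-5911-s2` (planner, crux-strategist mode), 2026-08-17.  An ALTERNATIVE skeleton
for the open residue of the crux — the HORIZONTAL (transverse) clause `Split.HorizontalClause` (the crux is kernel-equivalent to
it, `Split.iKMixedBoxCrossing_iff_horizontal`, p143979) — registered next to, never over, the lead's live skeleton
`Lines/defect_closure_exploration.lean` (v6, one stub = the clause itself).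

THE LEVER (card `Lines/quenched-chain-fkg.md`, §1–§3).  The colour law of the column-mixed IK field on a box is
`2^{-|Λ|} ∏_{f ⊆ Λ, f ∈ S-cols} (1 + ρ χ_f)`, i.e. (c3 L1, landed `stub_colourLawMixture`) the uniform measure on the linear code
`{σ : σ even on every face of D}` averaged over an i.i.d. Bernoulli(ρ) DEFECT set `D` of `S`-faces (`ρ = 7 − 4√3`).  NEW TWIST:
the uniform measure on ANY finite set `V ∋ 0, 𝟙` of colourings of a defect cluster is the UNIFORM MIXTURE, over the "patterns"
`v ∈ V ∖ {0, 𝟙}`, of the three-point CHAIN measures `(1/|V|) δ_0 + ((|V|−2)/|V|) δ_v + (1/|V|) δ_𝟙` — each supported on the totally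
ordered set `0 ≤ v ≤ 𝟙`, hence positively associated; products of such with the fair product measure on the free cells are
positively associated (Harris / Esary–Proschan–Walkup).  So, EXACTLY and for EVERY pattern `S`:
    `P_S = ∫ P_ξ dπ_S(ξ)`,  `ξ = (defect set D, diagonal coins, one pattern v_K per D-cluster K)` — a COLOURLESS environment —
    and every `P_ξ` satisfies Harris–FKG for black-increasing events (the bond field is increasing in the black set at fixed coins).
Consequently `P_S(A₁ ∩ … ∩ A_k) ≥ E_ξ[∏ P_ξ(A_i)] ≥ ∏ P_S(A_i) − (k−1)·max_i sd_ξ(P_ξ(A_i))` for black-increasing `A_i`: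
HARRIS HOLDS UP TO THE ENVIRONMENT-VARIANCE OF QUENCHED CROSSING PROBABILITIES, an irrelevant-disorder quantity (Harris criterion
`dν = 8/3 > 2`) which the seat's Monte-Carlo (card §4: `sim/quenched.c`, colourless environment, n = 8…64, patterns univ / alt / alt3 /
half) finds to decay like `n^{-1/2}` (`Var_ξ P_ξ(LR n×n)`: univ .0078 → .0055 → .0039 → .0025; alt .0034 → .0018 → .0012 → .0007), with
`E_ξ[p_A p_B] = P(A)P(B) ± 10⁻³` for every tested pair and the RSW glue product within +0…8 % of the product of the annealed
probabilities (truth ≈ 2.5× larger).  This is the first FKG substitute on this crux in which positive association is AVAILABLE (quenched)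
rather than replaced; what it leaves is (i) a concentration statement for quenched crossing probabilities (`stub_approxHarris7`, in its
mechanism-agnostic consequence form) and (ii) the anisotropy floor (`stub_isotropyFloorAll`), which no gluing mechanism touches.

STUBS (3) and composition: `stub_isotropyFloorAll` (squares are crossed transversally, ∀S — the anisotropy layer; numerically ≥ 0.499),
`stub_approxHarris7` (approximate Harris for the seven box events of the symmetry-free glue, deficit → 0 uniformly in S — the
quenched-concentration layer), `stub_rswAssembly` (isotropy + approximate Harris + the LANDED vertical clause + planar gluing ⇒ the
horizontal clause — provable now, L-sized), `IKMixedBoxCrossing_of` (the three statements ⇒ the crux BY NAME, through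
`Split.IKMixedBoxCrossing_of_horizontal`).

DISPROOF USED (`Cruxes/IKMixedBoxCrossing/Disproof.lean`, landed `Theorems/IKMixedBoxCrossing/Negative/*`):
`iKMixedBoxCrossing_false_without_n_pos` — honoured (`1 ≤ n` in `IsotropyFloorAll`, `n₀ ≤ n` with `2 ≤ n₀` usable in `ApproxHarris7`,
small `n` handled inside `stub_rswAssembly` by the all-black bottom row); `c_le_quarter` / `not_IKMixedBoxCrossing_with_large_constant` —
respected (all constants existential); `colourField_not_positivelyAssociated` / `bondField_not_positivelyAssociated` — respected and
EXPLAINED: positive association is claimed only CONDITIONALLY on the colourless environment `ξ`; annealing over the pattern `v_K`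
of a defect face reproduces exactly the refuter's one-face witness `Cov = −ρ/16`.  No stub is an instance of a landed Negative lemma.
-/

noncomputable section

namespace Summit.CriticalPhenomena.CardyFormulaZ2.Cruxes.IKMixedBoxCrossing.QuenchedChainFKG

open scoped Classical
open MeasureTheory
open Summit.CriticalPhenomena.CardyFormulaZ2.Theorems.IKLinearTransport.PinnedDiagramExchange
  (Ω μIK obs lrCross tbCross)
open Summit.CriticalPhenomena.CardyFormulaZ2.Cruxes.IKMixedBoxCrossing.PairedMirrorExploration (pLR pTB)

/-! ## §1 The three statements -/

/-- **ISOTROPY FLOOR, every pattern** (the anisotropy layer): squares are crossed TRANSVERSALLY (left-to-right, across the typed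
face columns) with probability bounded below uniformly in the pattern, the scale and the position.  By the exact duality
`pLR S a b n n + pTB S a b n n = 1` it can only fail through unbounded effective anisotropy of a columnar mixture of two self-dual
media; numerically `pLR ≥ 0.499` for every tested pattern (c7 §2), the sharp value `1/2` being FALSE for mixed patterns.
A statement the line POSITS (registered stub), not asserted. -/
def IsotropyFloorAll : Prop :=
  ∃ δ : ℝ, 0 < δ ∧ ∀ S : Set ℤ, ∀ n : ℕ, 1 ≤ n → ∀ a b : ℤ, δ ≤ pLR S a b n n

/-- The shift of the symmetry-free glue: `s = ⌈n/3⌉` (so `1 ≤ s`, `2s ≤ n` and `n ≤ 4s` for `2 ≤ n`). -/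
def glueShift (n : ℕ) : ℕ := (n + 2) / 3

/-- The SEVEN black-increasing box events of the symmetry-free glue inside the `2n × n` box at `(a,b)`, `s = glueShift n`:
LR crossings of the four `n × n` squares at column offsets `0, s, 2s, n` and BT crossings of the three overlap strips
`[a+s, a+n)`, `[a+2s, a+s+n) ∩ [a+2s, a+n)… = [a+2s, a+n+s) ⊇ [a+2s,a+n)` (width `n − s`) and `[a+n, a+n+2s)` (width `2s`), all of
height `n`.  Their intersection contains a black LR crossing of the `2n × n` box (planar gluing, part of `RSWAssembly`). -/
def glueEvent (S : Set ℤ) (n : ℕ) (a b : ℤ) : Set Ω :=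
  obs S ⁻¹' (lrCross a b n n ∩ lrCross (a + glueShift n) b n n ∩ lrCross (a + 2 * glueShift n) b n n ∩ lrCross (a + n) b n n ∩
    tbCross (a + glueShift n) b (n - glueShift n) n ∩ tbCross (a + 2 * glueShift n) b (n - glueShift n) n ∩
    tbCross (a + n) b (2 * glueShift n) n)

/-- Product of the seven annealed probabilities of the glue events. -/
def glueProduct (S : Set ℤ) (n : ℕ) (a b : ℤ) : ℝ :=
  pLR S a b n n * pLR S (a + glueShift n) b n n * pLR S (a + 2 * glueShift n) b n n * pLR S (a + n) b n n *
    pTB S (a + glueShift n) b (n - glueShift n) n * pTB S (a + 2 * glueShift n) b (n - glueShift n) n *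
    pTB S (a + n) b (2 * glueShift n) n

/-- **APPROXIMATE HARRIS FOR THE GLUE** (the quenched-concentration layer, stated mechanism-free): the seven glue events are
positively correlated up to a deficit that vanishes as `n → ∞`, UNIFORMLY in the pattern and the position.  Route of the card: exact
Harris–FKG conditionally on the colourless defect environment `ξ` (chain decomposition of the uniform measure on each defect code)
gives `μ(∩) ≥ E_ξ ∏ P_ξ(·)`, and `E_ξ ∏ P_ξ(·) ≥ ∏ E_ξ P_ξ(·) − 6 · max sd_ξ`, so the statement follows from
`sup_{S,a,b} Var_ξ(P_ξ(box event at scale n)) → 0` (two-replica co-pivotality; numerically `≍ n^{-1/2}`).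
A statement the line POSITS (registered stub), not asserted. -/
def ApproxHarris7 : Prop :=
  ∀ η : ℝ, 0 < η → ∃ n₀ : ℕ, ∀ S : Set ℤ, ∀ n : ℕ, n₀ ≤ n → ∀ a b : ℤ,
    glueProduct S n a b - η ≤ μIK.real (glueEvent S n a b)

/-- **RSW ASSEMBLY** (provable now; no symmetry, no positive association of the annealed field): from the isotropy floor
(`δ`), the LANDED vertical clause ∀S (`Split.verticalClause_holds`: BT crossings of `w × 2w` boxes, hence of the three overlap
strips, whose heights are `≤` twice their widths), approximate Harris at `η = δ⁴ c_V³ / 2`, and planar gluing of the seven events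
into an LR crossing of the `2n × n` box; scales `n < max n₀ 2` by the all-black bottom row (`≥ 4^{-n}`, row colours are i.i.d. fair
for every `S`).  A statement the line POSITS (registered stub), not asserted. -/
def RSWAssembly : Prop :=
  IsotropyFloorAll → ApproxHarris7 → Split.HorizontalClause

/-! ## §2 Registered stubs -/

/-- STUB 1 (anisotropy layer; hardest-without-attack): the isotropy floor for every pattern. -/
theorem stub_isotropyFloorAll : IsotropyFloorAll := by
  sorry

/-- STUB 2 (quenched-concentration layer; the line's NEW content): approximate Harris for the seven glue events. -/
theorem stub_approxHarris7 : ApproxHarris7 := by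
  sorry

/-- STUB 3 (assembly; provable now, L-sized): isotropy + approximate Harris + landed vertical clause ⇒ the horizontal clause. -/
theorem stub_rswAssembly : RSWAssembly := by
  sorry

/-! ## §3 Composition: the three statements imply the crux BY NAME -/

/-- **COMPOSITION** (kernel-checked, sorry-free): the three stub statements imply the crux decl of the payload route. -/
theorem IKMixedBoxCrossing_of :
    IsotropyFloorAll → ApproxHarris7 → RSWAssembly →
      Summit.CriticalPhenomena.CardyFormulaZ2.Theses.CardyIKTransport.IKMixedBoxCrossing :=
  fun hIso hAH hAsm => Split.IKMixedBoxCrossing_of_horizontal (hAsm hIso hAH)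

/-- The same for the home-route copy of the decl (CardyDiluteOrbit). -/
theorem IKMixedBoxCrossing_of_diluteOrbit :
    IsotropyFloorAll → ApproxHarris7 → RSWAssembly →
      Summit.CriticalPhenomena.CardyFormulaZ2.Theses.CardyDiluteOrbit.IKMixedBoxCrossing :=
  fun hIso hAH hAsm => Split.IKMixedBoxCrossing_of_horizontal_diluteOrbit (hAsm hIso hAH)

/-- The line closes the crux modulo its three stubs. -/
theorem IKMixedBoxCrossing_proof :
    Summit.CriticalPhenomena.CardyFormulaZ2.Theses.CardyIKTransport.IKMixedBoxCrossing :=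
  IKMixedBoxCrossing_of stub_isotropyFloorAll stub_approxHarris7 stub_rswAssembly

/-! ## §4 Elementary facts about the glue geometry (sanity of the statements; sorry-free) -/

theorem one_le_glueShift {n : ℕ} (hn : 1 ≤ n) : 1 ≤ glueShift n := by
  unfold glueShift; omega

theorem two_mul_glueShift_le {n : ℕ} (hn : 2 ≤ n) : 2 * glueShift n ≤ n := by
  unfold glueShift; omega

theorem le_four_mul_glueShift (n : ℕ) : n ≤ 4 * glueShift n := by
  unfold glueShift; omega

/-- The overlap strips are at most twice as tall as wide, so the landed vertical clause bounds their BT crossings. -/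
theorem overlap_aspect {n : ℕ} (hn : 2 ≤ n) : n ≤ 2 * (n - glueShift n) ∧ n ≤ 2 * (2 * glueShift n) := by
  unfold glueShift; omega

/-- THE CHAIN DECOMPOSITION behind `ApproxHarris7` (finite, exact): on any finite set `V` of colourings containing the all-white
and the all-black colouring and at least one more element, the uniform average of `g` equals the uniform average over the
"patterns" `v ∈ V ∖ {⊥, ⊤}` of the three-point chain averages `(g ⊥ + (|V|−2) g v + g ⊤)/|V|`.  (Each chain `⊥ ≤ v ≤ ⊤` carries a
positively associated measure; this identity is what makes the defect environment colourless.) -/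
theorem chain_decomposition {α : Type*} [DecidableEq α] (V : Finset α) (bot top : α) (hb : bot ∈ V) (ht : top ∈ V)
    (hbt : bot ≠ top) (hV : 2 < V.card) (g : α → ℝ) :
    (∑ x ∈ V, g x) / V.card =
      (∑ v ∈ (V.erase bot).erase top, (g bot + (V.card - 2 : ℝ) * g v + g top) / V.card) / ((V.card : ℝ) - 2) := by
  have hcard : (((V.erase bot).erase top).card : ℝ) = V.card - 2 := by
    have h1 : top ∈ V.erase bot := Finset.mem_erase.mpr ⟨hbt.symm, ht⟩
    rw [Finset.card_erase_of_mem h1, Finset.card_erase_of_mem hb]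
    have : 2 ≤ V.card := by omega
    push_cast [Nat.sub_sub, this]
    ring
  have hV' : (V.card : ℝ) - 2 ≠ 0 := by
    have : (2 : ℝ) < V.card := by exact_mod_cast hV
    linarith
  have hVne : (V.card : ℝ) ≠ 0 := by
    have : (2 : ℝ) < V.card := by exact_mod_cast hV
    linarith
  have hsum : ∑ x ∈ V, g x = g bot + g top + ∑ v ∈ (V.erase bot).erase top, g v := by
    have h1 : top ∈ V.erase bot := Finset.mem_erase.mpr ⟨hbt.symm, ht⟩
    rw [← Finset.add_sum_erase V g hb, ← Finset.add_sum_erase _ g h1]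
    ring
  rw [hsum]
  have key : ∑ v ∈ (V.erase bot).erase top, (g bot + ((V.card : ℝ) - 2) * g v + g top) / V.card
      = (((V.erase bot).erase top).card : ℝ) * ((g bot + g top) / V.card)
        + (((V.card : ℝ) - 2) / V.card) * ∑ v ∈ (V.erase bot).erase top, g v := by
    have hterm : ∀ v, (g bot + ((V.card : ℝ) - 2) * g v + g top) / V.card
        = (g bot + g top) / V.card + (((V.card : ℝ) - 2) / V.card) * g v := fun v => by ring
    simp_rw [hterm]
    rw [Finset.sum_add_distrib, Finset.sum_const, nsmul_eq_mul, ← Finset.mul_sum]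
  rw [key, hcard]
  field_simp

end Summit.CriticalPhenomena.CardyFormulaZ2.Cruxes.IKMixedBoxCrossing.QuenchedChainFKG

end
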